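import Literature.AlgebraicGeometry.Resolution.LocalModels
import Literature.AlgebraicGeometry.Resolution.QuadraticTransforms
import Literature.AlgebraicGeometry.Resolution.ExcellentRings
import Mathlib.RingTheory.Localization.FractionRing
import HarnessLib

/-!
# The dimension of the frame after a local blowing up: residually algebraic valuations

Topic: `Literature/AlgebraicGeometry/Resolution`. PROOF side of `CossartPiltant2019Local`
(`ArithmeticalThreefoldsLocal.lean`; Cossart–Piltant 2019, journal Thm. 1.5 = arXiv v1 Thm. 1.4).
The local theorem is stated for a regular local base `S` of Krull dimension THREE; after a
local blowing up along `μ` the new base `S' = 𝒪_{𝒮',s'}` (v1 Prop. 2.7; in the tree a local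
blowing up `R₁ = (R[b])_{𝔪_O ∩ R[b]}` of the subring `R ⊆ L`, `LocalBlowup.lean`,
`QuadraticTransforms.lean`) has dimension three again exactly when the centre `s'` of `μ` is a
closed point of the fibre, which is automatic when `μ` is RESIDUALLY ALGEBRAIC (`κ(μ)` algebraic
over `k = R/𝔪_R`) — the case to which Cossart–Piltant reduce (v1 Cor. 5.2: "Theorem 1.3 has
been reduced to theorem 1.4 for residually algebraic valuations"). This is the dimension formula
(Matsumura Thm. 15.6) for the universally catenary (e.g. excellent) local domain `R`, available
in the tree for models inside the fraction field (`ringKrullDim_localization_centre_eq`,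
`LocalModels.lean`, `DimensionFormula.lean`). This file transports it to the in-field frames of
`ArithmeticalThreefoldsLocalInField.lean` (subrings of the big field `L ⊋ Frac R`):

* `map_locAtCentre_comap` — local rings at the centre commute with field embeddings:
  `f((T)_{𝔪_{O∩K} ∩ T}) = (f T)_{𝔪_O ∩ fT}` for `f : K → L`, `O ⊆ L`;
* `ringKrullDim_locAtCentre_closure_eq` — **`dim (R[b])_{𝔪_O ∩ R[b]} = dim R`** for a
  universally catenary local domain `R ⊆ O ⊆ L` dominated by the valuation ring `O` with
  residue field algebraic over that of `R`, and a finite `b ⊆ O` consisting of FRACTIONS of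
  elements of `R` (the model is pulled back to `Frac R`, where the tree's dimension formula
  applies, and pushed forward again);
* `ringKrullDim_eq_of_isQuadraticTransformAlong` — in particular the quadratic transform of `R`
  along a residually algebraic `O` has the dimension of `R` (so the frame of
  `ArithmeticalThreefoldsLocalFrameStep.lean` is again three-dimensional);
* `residuallyAlgebraic_of_le`, `not_mem_maximalIdeal_of_le` — residual algebraicity passes from
  `R` to any local overring `R ≤ R₁ ⊆ L` (a polynomial over `R` with a unit coefficient keeps a
  unit coefficient over `R₁`).

Everything is PROVED; no definitions and no named facts are introduced.

## Sources

* V. Cossart, O. Piltant, J. Algebra 529 (2019) 268–535 = arXiv:1412.0868: Prop. 2.7 (arXiv v1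
  p. 14), Cor. 5.2 (p. 58), Prop. 4.6 (p. 52: reduction to residually algebraic valuations).
  [CossartPiltant2019]
* H. Matsumura, *Commutative Ring Theory* (1986), Thm. 15.6 — through `LocalModels.lean`.
  [Matsumura1987]
-/

noncomputable section

open IsLocalRing Polynomial

namespace Literature.AlgebraicGeometry.Resolution

universe u

/-! ## Local rings at the centre and field embeddings -/

section Embedding

variable {K L : Type u} [Field K] [Field L] (O : ValuationSubring L) (f : K →+* L)

/-- An element of `K` is a `v`-unit of `O ∩ K` iff its image is a `v`-unit of `O`. [folklore] -/
theorem valuation_comap_ringHom_eq_one_iff (x : K) :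
    (O.comap f).valuation x = 1 ↔ O.valuation (f x) = 1 := by
  rw [← not_iff_not]
  constructor
  · intro hx h1
    apply hx
    have hxO : x ∈ O.comap f := by
      rw [ValuationSubring.mem_comap, ← O.valuation_le_one_iff, h1]
    have hle : (O.comap f).valuation x ≤ 1 := ((O.comap f).valuation_le_one_iff x).mpr hxO
    rcases hle.lt_or_eq with hlt | heq
    · rw [valuation_comap_lt_one_iff] at hlt
      rw [h1] at hlt
      exact absurd hlt (lt_irrefl 1)
    · exact heq
  · intro hx h1
    apply hx
    have hxO : f x ∈ O := by
      rw [← ValuationSubring.mem_comap, ← (O.comap f).valuation_le_one_iff, h1]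
    have hle : O.valuation (f x) ≤ 1 := (O.valuation_le_one_iff _).mpr hxO
    rcases hle.lt_or_eq with hlt | heq
    · rw [← valuation_comap_lt_one_iff O f] at hlt
      rw [h1] at hlt
      exact absurd hlt (lt_irrefl 1)
    · exact heq

/-- **Local rings at the centre commute with field embeddings**: for `f : K → L`, a valuation
ring `O` of `L` and a subring `T ⊆ K`, the image of `T_{𝔪_{O ∩ K} ∩ T}` is
`(fT)_{𝔪_O ∩ fT}`. [folklore] -/
theorem map_locAtCentre_comap (T : Subring K) :
    (locAtCentre T (O.comap f)).map f = locAtCentre (T.map f) O := by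
  ext z
  constructor
  · rintro ⟨w, ⟨y, hy, s, hs, hvs, rfl⟩, rfl⟩
    refine ⟨f y, ⟨y, hy, rfl⟩, f s, ⟨s, hs, rfl⟩, (valuation_comap_ringHom_eq_one_iff O f s).mp hvs, ?_⟩
    rw [map_div₀]
  · rintro ⟨_, ⟨y, hy, rfl⟩, _, ⟨s, hs, rfl⟩, hvs, rfl⟩
    exact ⟨y / s, ⟨y, hy, s, hs, (valuation_comap_ringHom_eq_one_iff O f s).mpr hvs, rfl⟩, map_div₀ f y s⟩

end Embedding

/-! ## The dimension of a local blowing up of a residually algebraic valuation -/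

section Dimension

variable {L : Type u} [Field L] (O : ValuationSubring L) {R : Subring L} [IsLocalRing R]

/-- **`dim (R[b])_{𝔪_O ∩ R[b]} = dim R` for residually algebraic `O`.** Let `R ⊆ L` be a
universally catenary local subring (a domain) contained in and dominated by the valuation ring
`O` of `L`, with `κ(O)` algebraic over `R/𝔪_R` in the elementary sense (every `y ∈ O` is a root
modulo `𝔪_O` of a polynomial over `R` with a unit coefficient), and let `b ⊆ L` be finitely
many fractions of elements of `R` with `R[b] ⊆ O`. Then the local ring `(R[b])_{𝔪_O ∩ R[b]}`
has the Krull dimension of `R` — the dimension formula (Matsumura Thm. 15.6,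
`ringKrullDim_localization_centre_eq`) for the model `R[b'] ⊆ Frac R`, `f(b') = b`, of the
valuation ring `O ∩ Frac R`, transported along `Frac R → L`. For Cossart–Piltant's frames: the
base `S' = 𝒪_{𝒮',s'}` after a local blowing up along a residually algebraic `μ` is again
three-dimensional. [cite: Matsumura1987, Thm. 15.6]
[cite: CossartPiltant2019, Prop. 2.7 and Cor. 5.2 (arXiv v1 pp. 14, 58)] -/
theorem ringKrullDim_locAtCentre_closure_eq (hR : IsUniversallyCatenaryRing R)
    (hRO : R ≤ O.toSubring) (hdom : ∀ r : R, r ∈ maximalIdeal R → O.valuation (r : L) < 1)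
    (halg : ∀ y : O, ∃ q : R[X], (∃ i, q.coeff i ∉ maximalIdeal R) ∧
      O.valuation (aeval (y : L) q) < 1)
    (b : Finset L) (hb : ∀ y ∈ b, ∃ a d : R, (d : L) ≠ 0 ∧ y = a / d)
    (hBO : Subring.closure ((R : Set L) ∪ ↑b) ≤ O.toSubring) :
    ringKrullDim (locAtCentre (Subring.closure ((R : Set L) ∪ ↑b)) O) = ringKrullDim R := by
  classical
  haveI : IsDomain R := inferInstance
  -- the fraction field `K` of `R` and its embedding `f : K → L`
  let K := FractionRing R
  have hinj : Function.Injective (algebraMap R L) := Subtype.val_injective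
  let f : K →+* L := IsFractionRing.lift hinj
  have hf : ∀ r : R, f (algebraMap R K r) = r := fun r => IsFractionRing.lift_algebraMap hinj r
  let fₐ : K →ₐ[R] L := { f with commutes' := hf }
  have hfₐ : ∀ k : K, fₐ k = f k := fun _ => rfl
  set O' : ValuationSubring K := O.comap f with hO'
  have hAO' : ∀ a : R, algebraMap R K a ∈ O' := fun a => by
    rw [hO', ValuationSubring.mem_comap, hf]; exact hRO a.2
  have hdom' : ∀ a ∈ maximalIdeal R, O'.valuation (algebraMap R K a) < 1 := fun a ha => by
    rw [hO', valuation_comap_lt_one_iff, hf]; exact hdom a ha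
  have halg' : ∀ y : O', ∃ q : R[X], (∃ i, q.coeff i ∉ maximalIdeal R) ∧
      O'.valuation (q.eval₂ (algebraMap R K) y) < 1 := by
    intro y
    have hy : f y ∈ O := (ValuationSubring.mem_comap).mp y.2
    obtain ⟨q, hq, hv⟩ := halg ⟨f y, hy⟩
    refine ⟨q, hq, ?_⟩
    show (O.comap f).valuation (q.eval₂ (algebraMap R K) (y : K)) < 1
    rw [valuation_comap_lt_one_iff, hom_eval₂, show f.comp (algebraMap R K) = algebraMap R L from
      RingHom.ext hf, ← aeval_def]
    exact hv
  -- the generators pulled back to `K`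
  have hpre : ∀ y : b, ∃ k : K, f k = y := by
    rintro ⟨y, hy⟩
    obtain ⟨a, d, hd, rfl⟩ := hb y hy
    refine ⟨algebraMap R K a / algebraMap R K d, ?_⟩
    rw [map_div₀, hf, hf]
  choose g hg using hpre
  let s : Finset K := Finset.univ.image g
  have hfs : (fₐ : K → L) '' (s : Set K) = (b : Set L) := by
    ext y
    simp only [Set.mem_image, Finset.coe_image, Finset.coe_univ, Set.image_univ, Set.mem_range,
      Finset.mem_coe, s]
    constructor
    · rintro ⟨k, ⟨y', rfl⟩, rfl⟩
      rw [hfₐ, hg]; exact y'.2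
    · intro hy
      exact ⟨g ⟨y, hy⟩, ⟨⟨y, hy⟩, rfl⟩, by rw [hfₐ, hg]⟩
  -- the model `T = R[s] ⊆ O'` and its image `B = R[b]`
  set T : Subalgebra R K := Algebra.adjoin R (s : Set K) with hT
  set B : Subring L := Subring.closure ((R : Set L) ∪ ↑b) with hB
  have hTB : (T.map fₐ).toSubring = B := by
    rw [hT, AlgHom.map_adjoin, hfs, Algebra.adjoin_eq_ring_closure, hB]
    congr 1
    ext y
    simp only [Set.mem_union, Set.mem_range, SetLike.mem_coe]
    constructor
    · rintro (⟨r, rfl⟩ | hy)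
      · exact Or.inl r.2
      · exact Or.inr hy
    · rintro (hy | hy)
      · exact Or.inl ⟨⟨y, hy⟩, rfl⟩
      · exact Or.inr hy
  have hTmap : T.toSubring.map f = B := by
    rw [← hTB]
    ext z
    simp only [Subring.mem_map, Subalgebra.mem_toSubring, Subalgebra.mem_map]
    constructor
    · rintro ⟨t, ht, rfl⟩; exact ⟨t, ht, rfl⟩
    · rintro ⟨t, ht, rfl⟩; exact ⟨t, ht, rfl⟩
  have hTO : ∀ z : T, (z : K) ∈ O' := by
    intro z
    rw [hO', ValuationSubring.mem_comap]
    apply hBO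
    rw [← hTmap]
    exact ⟨z, z.2, rfl⟩
  have hTO' : T.toSubring ≤ O'.toSubring := fun z hz => hTO ⟨z, hz⟩
  -- the centre of `O'` on `T` and the dimension formula
  let P : Ideal T := Ideal.comap (Subring.inclusion hTO') (maximalIdeal O')
  haveI : P.IsPrime := Ideal.IsPrime.comap _
  have hP : ∀ z : T, z ∈ P ↔ O'.valuation (z : K) < 1 :=
    fun z => mem_comap_inclusion_maximalIdeal_iff O' T hTO' z
  have hdim : ringKrullDim (Localization.AtPrime P) = ringKrullDim R :=
    ringKrullDim_localization_centre_eq O' hR hAO' hdom' halg' s hTO P hP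
  -- `T_P ≅ locAtCentre T O' ≅ f(locAtCentre T O') = locAtCentre B O`
  have e₁ : Localization.AtPrime P ≃+* locAtCentre T.toSubring O' :=
    (locAtCentreEquiv hTO').toRingEquiv
  have e₂ : locAtCentre T.toSubring O' ≃+* (locAtCentre T.toSubring O').map f :=
    Subring.equivMapOfInjective _ f f.injective
  have e₃ : (locAtCentre T.toSubring O').map f = locAtCentre B O := by
    rw [hO', map_locAtCentre_comap, hTmap]
  rw [← hdim]
  exact (ringKrullDim_eq_of_ringEquiv (e₁.trans (e₂.trans (RingEquiv.subringCongr e₃)))).symm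

/-- **The quadratic transform along a residually algebraic valuation has the dimension of the
base**: for a universally catenary local subring `R ⊆ O` dominated by `O` with `κ(O)` algebraic
over `R/𝔪_R`, every quadratic transform `R₁ = (R[𝔪_R/c])_{𝔪_O ∩ R[𝔪_R/c]}` of `R` along `O`
(`IsQuadraticTransformAlong`) satisfies `dim R₁ = dim R`. (Cossart–Piltant's frame after the
first blowing up at the centre of a residually algebraic `μ` is again three-dimensional.)
[cite: CossartPiltant2019, Prop. 2.7 and Cor. 5.2 (arXiv v1 pp. 14, 58)] -/
theorem ringKrullDim_eq_of_isQuadraticTransformAlong (hR : IsUniversallyCatenaryRing R)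
    (hdom : ∀ r : R, r ∈ maximalIdeal R → O.valuation (r : L) < 1)
    (halg : ∀ y : O, ∃ q : R[X], (∃ i, q.coeff i ∉ maximalIdeal R) ∧
      O.valuation (aeval (y : L) q) < 1)
    {R₁ : Subring L} (hq : IsQuadraticTransformAlong O R R₁) :
    ringKrullDim R₁ = ringKrullDim R := by
  classical
  have hRO := hq.source_le
  have hR₁O := hq.target_le
  obtain ⟨_, c, hcm, hc0, -, rfl⟩ := hq.exists_eq_locAtCentre
  obtain ⟨_, u, hu⟩ := hq.fg_maximalIdeal
  have hc0' : ((c : R) : L) ≠ 0 := fun h0 => hc0 (Subtype.ext h0)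
  have hBeq : blowupRing R (c : L) =
      Subring.closure ((R : Set L) ∪ ↑(u.image fun y : R => (y : L) / c)) := by
    rw [blowupRing_eq_closure_of_span_eq (c : L) (↑u) hu, Finset.coe_image]
  have hBO : Subring.closure ((R : Set L) ∪ ↑(u.image fun y : R => (y : L) / c)) ≤ O.toSubring := by
    rw [← hBeq]
    exact (le_locAtCentre _ O).trans hR₁O
  have e : locAtCentre (blowupRing R (c : L)) O =
      locAtCentre (Subring.closure ((R : Set L) ∪ ↑(u.image fun y : R => (y : L) / c))) O := by
    rw [hBeq]
  rw [ringKrullDim_eq_of_ringEquiv (RingEquiv.subringCongr e)]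
  refine ringKrullDim_locAtCentre_closure_eq O hR hRO hdom halg _ (fun y hy => ?_) hBO
  obtain ⟨a, ha, rfl⟩ := Finset.mem_image.mp hy
  exact ⟨a, c, hc0', rfl⟩

/-- **Residual algebraicity passes to local overrings**: if every `y ∈ O` is a root modulo `𝔪_O`
of a polynomial over `R` with a unit coefficient, the same holds over any local subring
`R ≤ R₁ ⊆ L` into which `R` maps locally (units of `R` are units of `R₁`, e.g. `R₁` dominates
`R`). [folklore] -/
theorem residuallyAlgebraic_of_le {R₁ : Subring L} [IsLocalRing R₁] (hle : R ≤ R₁)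
    (hloc : ∀ r : R, r ∉ maximalIdeal R → (⟨r, hle r.2⟩ : R₁) ∉ maximalIdeal R₁)
    (halg : ∀ y : O, ∃ q : R[X], (∃ i, q.coeff i ∉ maximalIdeal R) ∧
      O.valuation (aeval (y : L) q) < 1) :
    ∀ y : O, ∃ q : R₁[X], (∃ i, q.coeff i ∉ maximalIdeal R₁) ∧
      O.valuation (aeval (y : L) q) < 1 := by
  intro y
  obtain ⟨q, ⟨i, hi⟩, hv⟩ := halg y
  refine ⟨q.map (Subring.inclusion hle), ⟨i, ?_⟩, ?_⟩
  · rw [coeff_map]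
    exact hloc _ hi
  · have e1 : (algebraMap R₁ L).comp (Subring.inclusion hle) = algebraMap R L :=
      RingHom.ext fun _ => rfl
    rw [aeval_def, eval₂_map, e1, ← aeval_def]
    exact hv

/-- The units condition of `residuallyAlgebraic_of_le` holds when `R₁` dominates `R` inside a
valuation ring: an element of `R` outside `𝔪_R` is a unit of `R`, hence of `R₁`. [folklore] -/
theorem not_mem_maximalIdeal_of_le {R₁ : Subring L} [IsLocalRing R₁] (hle : R ≤ R₁)
    (r : R) (hr : r ∉ maximalIdeal R) : (⟨r, hle r.2⟩ : R₁) ∉ maximalIdeal R₁ := by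
  intro hm
  have hu : IsUnit r := by
    by_contra hnu
    exact hr ((mem_maximalIdeal r).mpr (mem_nonunits_iff.mpr hnu))
  have hu₁ : IsUnit ((⟨r, hle r.2⟩ : R₁)) := by
    obtain ⟨w, hw⟩ := hu.exists_right_inv
    exact isUnit_iff_exists_inv.mpr ⟨⟨w, hle w.2⟩, Subtype.ext (congrArg (Subtype.val : R → L) hw)⟩
  exact (mem_nonunits_iff.mp ((mem_maximalIdeal _).mp hm)) hu₁

end Dimension

end Literature.AlgebraicGeometry.Resolution

end
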